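import Summits.BirchSwinnertonDyer.BirchSwinnertonDyer.Theorems.ClassRecordThreeEulerHalvesAtThreeCartanCorrespondenceCut
import HarnessLib

/-!
# SUPPLY from PERMUTATION MODELS — the mod-3 fixed-vector condition comes for free

Helper file riding `--supports stmt-BirchSwinnertonDyer-19109` (crux `EulerHalvesAtThree`; UNREGISTERED sub-line
`Cruxes/EulerHalvesAtThree/Lines/cartan_corr`, seat `bsd-idea-10` g12). It serves the registered stub (SUPPLY)
`stub_cartanTorusLatticeSupply : CartanCorrespondence.CartanTorusLatticeSupply` of crux 23422's line `cartan` v11 (one Cartan torus lattice per prime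
`q ≠ 3`) by a REDUCTION BY NAME: `cartanTorusLatticeSupply_of_permModelSupply : CartanPermModelSupply → CartanTorusLatticeSupply`, where a
PERMUTATION MODEL (`CartanPermModel q`) is an integral representation `ρ` with character `χ_{W_q}` EMBEDDED equivariantly, injectively and PURELY
(`I v ∈ 3ℤ^S ⇒ v ∈ 3ℤ^d`) in a permutation lattice `ℤ^S` on a TRANSITIVE `GL₂(𝔽_q)`-set `S` with `3 ∤ #S`, with coordinate sum zero, plus the torus lines.
What the reduction REMOVES from the stub: the invariant positive-definite form (it is the restricted standard form `B(v,w) = Σ_s (Iv)(s)(Iw)(s)`: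
`permForm`, `permForm_symm ∕ _pos ∕ _inv`) and — the point of this file — the condition `(𝓛/3𝓛)^G = 0` (`noFixedVectorModThree_of_permModel`):
if `v ∈ 𝓛` is `G`-fixed mod `3𝓛` then `φ = Iv` is `G`-fixed mod `3ℤ^S`, hence CONSTANT mod `3` (transitivity), so `#S·φ(s) ≡ Σ_t φ(t) = 0 (mod 3)` and
`3 ∤ #S` forces `φ ≡ 0 (mod 3)`, whence `v ∈ 3ℤ^d` by purity. This answers the «ONE REAL RISK» of the LEAD's SUPPLY plan (tam3-p1 g22
`SUPPLY-STUB-PLAN.md` §A1(v): in Ribet's segment of lattices of `W_q` only one endpoint has no fixed vector mod 3) by NAMING a lattice that always works: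
the pure `χ_W`-isotypic sublattice of `ℤ[G/T]` for the torus `T` of index prime to `3` — `T = T_s` (`#G/T_s = q(q+1)`) when `q ≡ 1 (3)`, `T = T_ns`
(`#G/T_ns = q(q−1)`) when `q ≡ 2 (3)`; `W_q` occurs there exactly once (the torus-fixed space of `W_q` is a line: (C1) ∕ (P1) of the lineage), its
coordinate sums vanish (`Hom_G(W_q, 𝟙) = 0`), and both tori have fixed LINES in it. (At `q = 2` this is `ℤ[S₃/C₃] ⊃ sgn`, the LEAD's `signLattice`,
p690778.) What REMAINS per prime (the fields of `CartanPermModel`): the trace identity `trace_eq` (= «`W_q` is realised over `ℚ` inside `ℚ[G/T]` with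
multiplicity one» — for `q ≡ 1 (3)` the LEAD's Hecke ∕ descent construction §A1(ii)–(iii), or per-`q` certificates), the explicit torus lines and their
generation property, `η`. HONEST FRAMING: a reduction and its elementary lemmas; SUPPLY, NUM, (F2b♭), crux 23422 ∕ 19109 are NOT proved; BSD is proved for
no curve. [folklore]
-/

set_option linter.dupNamespace false
set_option autoImplicit false

namespace Summit.BirchSwinnertonDyer.BirchSwinnertonDyer.Theorems.CartanSupply

open Summit.BirchSwinnertonDyer.BirchSwinnertonDyer.Theorems.CartanDegree
open Summit.BirchSwinnertonDyer.BirchSwinnertonDyer.Theorems.CartanCorrespondence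

/-- A PERMUTATION MODEL of the Cartan torus lattice at `q`: an integral representation `ρ` of `GL₂(𝔽_q)` on `ℤ^d` with character `χ_{W_q}`,
embedded `G`-equivariantly (`I (ρ g v) (σ g i) = I v i`), injectively and purely into the permutation lattice `ℤ^n` of a transitive `G`-set
`Fin n` with `3 ∤ n`, with vanishing coordinate sums; plus the non-split torus `𝔽_q[η]^×` and generators of the two torus-fixed lines. -/
structure CartanPermModel (q : ℕ) where
  /-- rank of the lattice. -/
  d : ℕ
  /-- the `GL₂(𝔽_q)`-action on `ℤ^d`. -/
  ρ : Representation ℤ (GL (Fin 2) (ZMod q)) (Fin d → ℤ)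
  /-- character `= χ_{W_q}`. -/
  trace_eq : ∀ g, LinearMap.trace ℤ (Fin d → ℤ) (ρ g) = cubicNewvectorChar q g
  /-- size of the `G`-set. -/
  n : ℕ
  /-- the permutation action on `Fin n`. -/
  σ : GL (Fin 2) (ZMod q) →* Equiv.Perm (Fin n)
  /-- transitivity. -/
  σ_trans : ∀ i j : Fin n, ∃ g, σ g i = j
  /-- `3 ∤ #S`. -/
  three_not_dvd : ¬ 3 ∣ n
  /-- the embedding `ℤ^d ↪ ℤ^S`. -/
  I : (Fin d → ℤ) →ₗ[ℤ] (Fin n → ℤ)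
  I_inj : Function.Injective I
  /-- equivariance: `I(ρ g v) = (I v) ∘ (σ g)⁻¹`. -/
  I_equiv : ∀ g v i, I (ρ g v) (σ g i) = I v i
  /-- purity of the image: `I v ∈ 3ℤ^S ⇒ v ∈ 3ℤ^d`. -/
  I_pure : ∀ (v : Fin d → ℤ) (w : Fin n → ℤ), I v = (3 : ℤ) • w → ∃ u : Fin d → ℤ, v = (3 : ℤ) • u
  /-- coordinate sums vanish (`Hom_G(W_q, 𝟙) = 0`). -/
  I_sum : ∀ v, ∑ i, I v i = 0
  /-- the non-split torus `𝔽_q[η]^×`. -/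
  η : Matrix (Fin 2) (Fin 2) (ZMod q)
  η_irred : ¬ HasRatEigenvalue η
  /-- generators of the split- ∕ non-split-torus-fixed lines. -/
  wS : Fin d → ℤ
  wC : Fin d → ℤ
  wS_fixed : ∀ g : GL (Fin 2) (ZMod q), (g : Matrix (Fin 2) (Fin 2) (ZMod q)) 0 1 = 0 →
    (g : Matrix (Fin 2) (Fin 2) (ZMod q)) 1 0 = 0 → ρ g wS = wS
  wC_fixed : ∀ g : GL (Fin 2) (ZMod q), (g : Matrix (Fin 2) (Fin 2) (ZMod q)) * η = η * g → ρ g wC = wC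
  wS_gen : ∀ v : Fin d → ℤ, (∀ g : GL (Fin 2) (ZMod q), (g : Matrix (Fin 2) (Fin 2) (ZMod q)) 0 1 = 0 →
    (g : Matrix (Fin 2) (Fin 2) (ZMod q)) 1 0 = 0 → ρ g v = v) → ∃ m : ℤ, v = m • wS
  wC_gen : ∀ v : Fin d → ℤ, (∀ g : GL (Fin 2) (ZMod q), (g : Matrix (Fin 2) (Fin 2) (ZMod q)) * η = η * g → ρ g v = v) →
    ∃ m : ℤ, v = m • wC
  wS_ne : wS ≠ 0
  wC_ne : wC ≠ 0

/-- **PERMUTATION-MODEL SUPPLY**: every prime `q ≠ 3` carries a permutation model. (Intended witness: the pure `χ_{W_q}`-isotypic sublattice of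
`ℤ[G/T]`, `T` the torus of index prime to `3`.) [folklore] -/
@[conjecture]
def CartanPermModelSupply : Prop := ∀ q : ℕ, q.Prime → q ≠ 3 → Nonempty (CartanPermModel q)

variable {q : ℕ}

/-! ## §1 The restricted standard form -/

/-- The restricted standard form `B(v,w) = Σ_i (Iv)(i)·(Iw)(i)`. -/
def permForm (M : CartanPermModel q) : (Fin M.d → ℤ) →ₗ[ℤ] (Fin M.d → ℤ) →ₗ[ℤ] ℤ :=
  LinearMap.mk₂ ℤ (fun v w => ∑ i, M.I v i * M.I w i)
    (by intro v₁ v₂ w; simp only [map_add, Pi.add_apply, add_mul, Finset.sum_add_distrib])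
    (by intro c v w; simp only [map_smul, Pi.smul_apply, smul_eq_mul, mul_assoc, Finset.mul_sum])
    (by intro v w₁ w₂; simp only [map_add, Pi.add_apply, mul_add, Finset.sum_add_distrib])
    (by intro c v w; simp only [map_smul, Pi.smul_apply, smul_eq_mul, Finset.mul_sum, mul_left_comm])

/-- PROVED: unfolding. [folklore] -/
theorem permForm_apply (M : CartanPermModel q) (v w : Fin M.d → ℤ) : permForm M v w = ∑ i, M.I v i * M.I w i := rfl

/-- PROVED: symmetry. [folklore] -/
theorem permForm_symm (M : CartanPermModel q) (v w : Fin M.d → ℤ) : permForm M v w = permForm M w v := by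
  rw [permForm_apply, permForm_apply]
  exact Finset.sum_congr rfl (fun i _ => mul_comm _ _)

/-- PROVED: positivity (`I` injective). [folklore] -/
theorem permForm_pos (M : CartanPermModel q) (v : Fin M.d → ℤ) (hv : v ≠ 0) : 0 < permForm M v v := by
  rw [permForm_apply]
  have hIv : M.I v ≠ 0 := fun h => hv (M.I_inj (by rw [h, map_zero]))
  obtain ⟨i, hi⟩ : ∃ i, M.I v i ≠ 0 := by
    by_contra h
    simp only [not_exists, not_not] at h
    exact hIv (funext h)
  exact Finset.sum_pos' (fun j _ => mul_self_nonneg _) ⟨i, Finset.mem_univ _, mul_self_pos.mpr hi⟩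

/-- PROVED: `G`-invariance (reindex by `σ g`). [folklore] -/
theorem permForm_inv (M : CartanPermModel q) (g : GL (Fin 2) (ZMod q)) (v w : Fin M.d → ℤ) :
    permForm M (M.ρ g v) (M.ρ g w) = permForm M v w := by
  rw [permForm_apply, permForm_apply, ← Equiv.sum_comp (M.σ g) (fun i => M.I (M.ρ g v) i * M.I (M.ρ g w) i)]
  simp only [M.I_equiv]

/-! ## §2 No fixed vector mod 3 — automatic -/

/-- PROVED: in a permutation model, a vector fixed mod `3` by `G` has all `ℤ^S`-coordinates divisible by `3`. [folklore] -/
theorem coord_dvd_three_of_fixedModThree (M : CartanPermModel q) (v : Fin M.d → ℤ)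
    (hv : ∀ g, ∃ w : Fin M.d → ℤ, M.ρ g v - v = (3 : ℤ) • w) (i : Fin M.n) : (3 : ℤ) ∣ M.I v i := by
  -- `Iv` is constant mod 3
  have hmod : ∀ g j, (3 : ℤ) ∣ M.I v j - M.I v (M.σ g j) := by
    intro g j
    obtain ⟨w, hw⟩ := hv g
    have h1 : M.I (M.ρ g v - v) = (3 : ℤ) • M.I w := by rw [hw, map_smul]
    rw [map_sub] at h1
    have h2 := congrFun h1 (M.σ g j)
    simp only [Pi.sub_apply, Pi.smul_apply, smul_eq_mul, M.I_equiv] at h2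
    exact ⟨M.I w (M.σ g j), by linarith⟩
  have hconst : ∀ j, (3 : ℤ) ∣ M.I v i - M.I v j := by
    intro j
    obtain ⟨g, hg⟩ := M.σ_trans i j
    have := hmod g i
    rwa [hg] at this
  -- sum over `j`: `n·(Iv)(i) = Σ_j ((Iv)(i) − (Iv)(j))` since the coordinate sum vanishes
  have hsum : ∑ j, (M.I v i - M.I v j) = (M.n : ℤ) * M.I v i := by
    rw [Finset.sum_sub_distrib, M.I_sum, sub_zero, Finset.sum_const, Finset.card_univ, Fintype.card_fin, nsmul_eq_mul]
  have hdvd : (3 : ℤ) ∣ (M.n : ℤ) * M.I v i := by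
    rw [← hsum]
    exact Finset.dvd_sum (fun j _ => hconst j)
  rcases Int.prime_three.dvd_or_dvd hdvd with h | h
  · exact absurd (Int.natCast_dvd_natCast.mp h) M.three_not_dvd
  · exact h

/-- PROVED — **THE MOD-3 CONDITION FOR FREE**: `(𝓛/3𝓛)^G = 0` for the lattice of any permutation model. [folklore] -/
theorem noFixedVectorModThree_of_permModel (M : CartanPermModel q) (v : Fin M.d → ℤ)
    (hv : ∀ g, ∃ w : Fin M.d → ℤ, M.ρ g v - v = (3 : ℤ) • w) : ∃ w : Fin M.d → ℤ, v = (3 : ℤ) • w := by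
  refine M.I_pure v (fun i => M.I v i / 3) (funext (fun i => ?_))
  simp only [Pi.smul_apply, smul_eq_mul]
  exact (Int.mul_ediv_cancel' (coord_dvd_three_of_fixedModThree M v hv i)).symm

/-! ## §3 The lattice and the reduction -/

/-- The Cartan torus lattice of a permutation model. -/
def toLattice (M : CartanPermModel q) : CartanTorusLattice q where
  d := M.d
  ρ := M.ρ
  trace_eq := M.trace_eq
  B := permForm M
  B_symm := permForm_symm M
  B_pos := permForm_pos M
  B_inv := permForm_inv M
  noFixedVectorModThree := noFixedVectorModThree_of_permModel M
  η := M.η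
  η_irred := M.η_irred

/-- PROVED — one prime at a time: a permutation model at `q` gives the `q`-instance of SUPPLY (provers may land `CartanPermModel q` for single
primes and feed this). [folklore] -/
theorem cartanTorusLatticeSupplyAt_of_permModel (M : CartanPermModel q) :
    ∃ (𝓛 : CartanTorusLattice q) (wS wC : Fin 𝓛.d → ℤ),
      𝓛.IsSplitFixed wS ∧ 𝓛.IsNonsplitFixed wC ∧
      (∀ v, 𝓛.IsSplitFixed v → ∃ m : ℤ, v = m • wS) ∧ (∀ v, 𝓛.IsNonsplitFixed v → ∃ m : ℤ, v = m • wC) ∧ wS ≠ 0 ∧ wC ≠ 0 :=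
  ⟨toLattice M, M.wS, M.wC, fun g h01 h10 => M.wS_fixed g h01 h10, fun g hg => M.wC_fixed g hg,
    fun v hv => M.wS_gen v hv, fun v hv => M.wC_gen v hv, M.wS_ne, M.wC_ne⟩

/-- PROVED — **SUPPLY ⟸ PERMUTATION-MODEL SUPPLY** (`CartanTorusLatticeSupply` BY NAME). [folklore] -/
theorem cartanTorusLatticeSupply_of_permModelSupply (h : CartanPermModelSupply) : CartanTorusLatticeSupply :=
  fun q hq h3 => (h q hq h3).elim fun M => cartanTorusLatticeSupplyAt_of_permModel M

end Summit.BirchSwinnertonDyer.BirchSwinnertonDyer.Theorems.CartanSupply
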